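import Literature.Analysis.FunctionSpaces.MellinPlancherelL2
import Literature.Analysis.FunctionSpaces.GaussianSchwartz
import Literature.Analysis.Fourier.L2FourierReflection
import Literature.Analysis.Fourier.FourierUniquenessL1
import Mathlib.Analysis.SpecialFunctions.Gaussian.FourierTransform
import Mathlib.Analysis.SpecialFunctions.Gamma.Deligne
import Mathlib.Analysis.MellinTransform
import HarnessLib

/-!
# The Mellin–Plancherel transform diagonalises the cosine transform:
# `𝓜(𝓕₊f)(½ + 2πiξ) = (Γℝ(½ + 2πiξ)/Γℝ(½ − 2πiξ)) · 𝓜f(½ − 2πiξ)` on even `L²`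

LINE 1 — LABEL: RH-FREE (`L²` harmonic analysis on `(0, ∞)`: the `L²` Fourier transform of an EVEN
square-integrable function, read through the Mellin–Plancherel isometry `𝓜 = mellinL2` of
`MellinPlancherelL2.lean`, is multiplication by the unimodular symbol `Γℝ(s)/Γℝ(1 − s)` on the critical
line `s = ½ + 2πiξ` composed with the reflection `ξ ↦ −ξ`). bears_on: B-C/B-P (COLUMN 6 DBR) as TOOLING
ONLY (consumer: the `𝓕`-side of Burnol 2004b Prop. 4.1 (ii), `Burnol2004b_prop4_1R`, row R18 of the
rh-crit dbl cell). WHAT THIS IS NOT: not a statement about `ζ` or its zeros, not a criterion, not a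
route; nothing here bears on the truth of RH.

Topic `Analysis/FunctionSpaces` (support file; theorems only, no definitions, no named facts).

## The statement

For `u ∈ L²(ℝ)` almost-everywhere EVEN, with `res = LpToLpRestrictCLM ℝ ℂ ℂ volume 2 (Ioi 0)` the
restriction `L²(ℝ) → L²(0,∞)` and `𝓜 = MellinL2.mellinL2 : L²(0,∞) ≃ₗᵢ L²(ℝ, dξ)` the Mellin–Plancherel
transform on the line `s = ½ + 2πiξ` (LEFT Mellin convention `𝓜f(s) = ∫₀^∞ f(t)t^{s−1}dt`):

  `𝓜(res(𝓕u))(ξ) = (Γℝ(½ + 2πiξ) / Γℝ(½ − 2πiξ)) · 𝓜(res u)(−ξ)`   for a.e. `ξ`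

(`mellinL2_restrict_fourier_of_even`). In Burnol's right-Mellin notation `f̂(s) = ∫₀^∞ f(t)t^{−s}dt =
𝓜f(1 − s)` this is the classical "`𝓕₊(f)^(s) = χ(s) f̂(1 − s)`, `χ(s) = Γℝ(1−s)/Γℝ(s)`" on the critical
line [Burnol2004b, §1 p. 4, TeX l.348–363: "These transforms are unitary identifications of
`K = L²(0,∞;dt)` with `L²(s=½+iτ; dτ/2π)` … The composite `𝓕₊·I` is scale invariant hence diagonalized
by the Mellin Transform, and this gives, on the critical line: `𝓕₊(f)^(s) = χ(s)f̂(1−s)` with a certain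
function `χ(s)` which we obtain easily from the choice `f(t) = 2exp(−πt²)` to be
`π^{s−1/2}Γ((1−s)/2)/Γ(s/2)`"], here as an identity of `L²(ℝ, dξ)` classes valid for EVERY even
`u ∈ L²(ℝ)` (no strip of absolute convergence is needed); the unitarity of `𝓜` is
`MellinPlancherelL2.lean` (Titchmarsh, *Introduction to the theory of Fourier integrals* (1948),
Thm. 71, as cited there).

## Proof

Both sides are continuous, additive and homogeneous in `u`. (G) On the Gaussians `γ_c(x) = e^{−πcx²}`
(`c > 0`) they agree by explicit computation: `𝓕γ_c = c^{−1/2}γ_{1/c}` (Mathlib `fourier_gaussian_pi`,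
carried to `L²` classes by `SchwartzMap.toLp_fourier_eq`), `𝓜γ_c(s) = c^{−s/2}Γℝ(s)/2` for `Re s > 0`
(Euler's integral after `t = √(u/πc)`, carried to `mellinL2` by the `L¹ ∩ L²` dictionary
`MellinL2.mellinL2_toLp_ae_eq_mellin`), and `c^{−1/2}·(c⁻¹)^{−s/2}Γℝ(s)/2 =
(Γℝ(s)/Γℝ(1−s))·c^{−(1−s)/2}Γℝ(1−s)/2`. (D) The span of the `γ_c` is dense in the even part of `L²(ℝ)`:
if `w` is even and orthogonal to every `γ_c`, then (evenness, `∫_ℝ = 2∫₀^∞`) `res w ⊥ res γ_c` in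
`L²(0,∞)`, hence (isometry) `𝓜(res w) ⊥ 𝓜(res γ_c) = c^{−1/4}e^{−πiξ log c}Γℝ(½+2πiξ)/2`; with
`c = e^{2b}` this says that the Fourier transform of the integrable function
`ξ ↦ conj(Γℝ(½ + 2πiξ)) · 𝓜(res w)(ξ)` vanishes at every `b ∈ ℝ`, so it vanishes a.e.
(`Literature.Analysis.Fourier.ae_eq_zero_of_forall_fourier_eq_zero`); `Γℝ ≠ 0` on the line gives
`𝓜(res w) = 0`, so `res w = 0`, so `w = 0` (even). A general `w ⊥ span{γ_c}` has `w + Rw` even and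
`⊥ span{γ_c}`, whence `Rw = −w` and `⟪w, u⟫ = ⟪Rw, Ru⟫ = −⟪w, u⟫ = 0` for even `u`: every even `u` lies
in `(span{γ_c})ᗮᗮ = closure(span{γ_c})`. (E) The two sides, packaged as continuous linear maps
`L²(ℝ) → L²(ℝ, dξ)`, agree on `span{γ_c}`, hence on its closure.

## References

* J.-F. Burnol, *Two complete and minimal systems associated with the zeros of the Riemann zeta
  function*, J. Théor. Nombres Bordeaux 16 (2004) 65–94 = arXiv:math/0203120v7, §1 p. 4
  (TeX l.350–365). [key `Burnol2004b`]
* E. C. Titchmarsh, *Introduction to the theory of Fourier integrals*, 2nd ed., Oxford (1948),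
  Thm. 71 (Mellin–Parseval; cited through `MellinPlancherelL2.lean`). [key `Titchmarsh1948`]
* L. Grafakos, *Classical Fourier Analysis*, 3rd ed., GTM 249 (2014), Prop. 2.2.11. [key `Grafakos2014`]
-/

noncomputable section

open MeasureTheory Real Complex Set Filter FourierTransform SchwartzMap
open scoped ENNReal Topology ComplexConjugate InnerProductSpace

namespace Literature.Analysis.FunctionSpaces

namespace MellinFourierMultiplier

/-! ## Part A. Gaussians: Mellin transforms and `L²` Fourier transforms -/

/-- The complex Gaussian Schwartz function on `ℝ`: `gaussianSchwartz ℝ a x = e^{−ax²}` (`0 < a`).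
[folklore] -/
private theorem gaussianSchwartz_real_apply {a : ℝ} (ha : 0 < a) (x : ℝ) :
    gaussianSchwartz ℝ a x = ((Real.exp (-a * x ^ 2) : ℝ) : ℂ) := by
  rw [gaussianSchwartz_apply ha, Real.norm_eq_abs, sq_abs]

/-- The Gaussian Schwartz function on `ℝ` as a function. [folklore] -/
private theorem coe_gaussianSchwartz_real {a : ℝ} (ha : 0 < a) :
    ⇑(gaussianSchwartz ℝ a) = fun x : ℝ ↦ ((Real.exp (-a * x ^ 2) : ℝ) : ℂ) :=
  funext (gaussianSchwartz_real_apply ha)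

/-- **Mellin transform of the Gaussian**: `∫₀^∞ x^{s−1} e^{−πx²} dx = Γℝ(s)/2 = π^{−s/2}Γ(s/2)/2` for
`Re s > 0` (substitute `u = x²` in Euler's integral). [cite: Burnol2004b, §1 p. 4 (arXiv:math/0203120v7, TeX l.348–363)] -/
theorem mellin_exp_neg_pi_sq {s : ℂ} (hs : 0 < s.re) :
    mellin (fun x : ℝ ↦ ((Real.exp (-π * x ^ 2) : ℝ) : ℂ)) s = Gammaℝ s / 2 := by
  set f : ℝ → ℂ := fun u ↦ Complex.exp (-((π : ℂ) * (u : ℂ))) with hf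
  have h1 : mellin (fun x : ℝ ↦ ((Real.exp (-π * x ^ 2) : ℝ) : ℂ)) s =
      mellin (fun t : ℝ ↦ f (t ^ (2 : ℝ))) s := by
    refine setIntegral_congr_fun measurableSet_Ioi fun t _ ↦ ?_
    simp only [hf, Real.rpow_two, Complex.ofReal_exp, Complex.ofReal_mul, Complex.ofReal_neg,
      Complex.ofReal_pow, neg_mul]
  have hs2 : 0 < (s / 2).re := by
    have : (s / 2).re = s.re / 2 := by simp
    rw [this]; linarith
  have h2 : mellin f (s / 2) = (1 / (π : ℂ)) ^ (s / 2) * Complex.Gamma (s / 2) := by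
    rw [mellin]
    simp_rw [smul_eq_mul]
    have h := Complex.integral_cpow_mul_exp_neg_mul_Ioi hs2 Real.pi_pos
    simpa only [hf, one_div] using h
  have harg : ((π : ℂ)).arg ≠ Real.pi := by
    rw [Complex.arg_ofReal_of_nonneg Real.pi_pos.le]; exact Real.pi_pos.ne
  rw [h1, mellin_comp_rpow]
  simp only [Complex.ofReal_ofNat]
  rw [h2, abs_two, Complex.real_smul, Complex.Gammaℝ_def, one_div,
    Complex.inv_cpow _ _ harg, neg_div, Complex.cpow_neg]
  push_cast
  ring

/-- `(√c)^w = c^{w/2}` for `c > 0` (principal powers of positive reals). [folklore] -/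
private theorem sqrt_cpow {c : ℝ} (hc : 0 < c) (w : ℂ) :
    ((Real.sqrt c : ℝ) : ℂ) ^ w = (c : ℂ) ^ (w / 2) := by
  have hsq : 0 < Real.sqrt c := Real.sqrt_pos.2 hc
  rw [cpow_def_of_ne_zero (ofReal_ne_zero.2 hsq.ne'), cpow_def_of_ne_zero (ofReal_ne_zero.2 hc.ne'),
    ← ofReal_log hsq.le, ← ofReal_log hc.le, Real.log_sqrt hc.le]
  congr 1
  push_cast
  ring

/-- `(c⁻¹)^w = c^{−w}` for `c > 0` (principal powers of positive reals). [folklore] -/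
private theorem inv_cpow_ofReal {c : ℝ} (hc : 0 < c) (w : ℂ) :
    ((c⁻¹ : ℝ) : ℂ) ^ w = (c : ℂ) ^ (-w) := by
  rw [cpow_def_of_ne_zero (ofReal_ne_zero.2 (inv_pos.2 hc).ne'),
    cpow_def_of_ne_zero (ofReal_ne_zero.2 hc.ne'), ← ofReal_log (inv_pos.2 hc).le,
    ← ofReal_log hc.le, Real.log_inv]
  congr 1
  push_cast
  ring

/-- The dilated Gaussian is the dilate of the standard one: `e^{−πc t²} = e^{−π(√c·t)²}`. [folklore] -/
private theorem gaussFun_eq_comp_sqrt_mul {c : ℝ} (hc : 0 < c) :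
    (fun t : ℝ ↦ ((Real.exp (-(π * c) * t ^ 2) : ℝ) : ℂ)) =
      fun t : ℝ ↦ ((Real.exp (-π * (Real.sqrt c * t) ^ 2) : ℝ) : ℂ) := by
  funext t
  rw [mul_pow, Real.sq_sqrt hc.le]
  ring_nf

/-- **Mellin transform of the dilated Gaussian**: `∫₀^∞ t^{s−1} e^{−πct²} dt = c^{−s/2}Γℝ(s)/2` for
`Re s > 0`, `c > 0`. [cite: Burnol2004b, §1 p. 4 (arXiv:math/0203120v7, TeX l.348–363)] -/
theorem mellin_gaussFun {c : ℝ} (hc : 0 < c) {s : ℂ} (hs : 0 < s.re) :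
    mellin (fun t : ℝ ↦ ((Real.exp (-(π * c) * t ^ 2) : ℝ) : ℂ)) s =
      (c : ℂ) ^ (-(s / 2)) * (Gammaℝ s / 2) := by
  rw [gaussFun_eq_comp_sqrt_mul hc,
    mellin_comp_mul_left (fun x : ℝ ↦ ((Real.exp (-π * x ^ 2) : ℝ) : ℂ)) s (Real.sqrt_pos.2 hc),
    mellin_exp_neg_pi_sq hs, sqrt_cpow hc, smul_eq_mul, neg_div]

/-- The Mellin transform of the dilated Gaussian converges absolutely for `Re s > 0`. [folklore] -/
private theorem mellinConvergent_gaussFun {c : ℝ} (hc : 0 < c) {s : ℂ} (hs : 0 < s.re) :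
    MellinConvergent (fun t : ℝ ↦ ((Real.exp (-(π * c) * t ^ 2) : ℝ) : ℂ)) s := by
  have hmeas : AEStronglyMeasurable (fun t : ℝ ↦ ((Real.exp (-(π * c) * t ^ 2) : ℝ) : ℂ))
      (volume.restrict (Ioi 0)) :=
    (Complex.continuous_ofReal.comp (by fun_prop)).aestronglyMeasurable
  rw [MellinConvergent, mellin_convergent_iff_norm Subset.rfl measurableSet_Ioi hmeas]
  have h := integrableOn_rpow_mul_exp_neg_mul_sq (mul_pos Real.pi_pos hc) (s := s.re - 1)
    (by linarith)
  refine h.congr_fun (fun x _ ↦ ?_) measurableSet_Ioi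
  simp only [Complex.norm_real, Real.norm_eq_abs, Real.abs_exp, neg_mul]

/-- The Gaussian `γ_c = e^{−πc x²}` is square integrable on `(0, ∞)` (it is a Schwartz function on `ℝ`).
[folklore] -/
private theorem memLp_gaussFun_restrict {c : ℝ} (hc : 0 < c) :
    MemLp (fun t : ℝ ↦ ((Real.exp (-(π * c) * t ^ 2) : ℝ) : ℂ)) 2 (volume.restrict (Ioi (0:ℝ))) := by
  have h := ((gaussianSchwartz ℝ (π * c)).memLp 2 (μ := (volume : Measure ℝ))).restrict (Ioi (0:ℝ))
  rwa [coe_gaussianSchwartz_real (mul_pos Real.pi_pos hc)] at h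

/-- The restriction to `(0,∞)` of the `L²(ℝ)` class of the Gaussian Schwartz function is the
`L²(0,∞)` class of `t ↦ e^{−πct²}`. [folklore] -/
private theorem restrict_toLp_gaussianSchwartz {c : ℝ} (hc : 0 < c) :
    LpToLpRestrictCLM ℝ ℂ ℂ (volume : Measure ℝ) 2 (Ioi (0:ℝ)) ((gaussianSchwartz ℝ (π * c)).toLp 2)
      = (memLp_gaussFun_restrict hc).toLp _ := by
  refine Lp.ext ?_
  have h1 := LpToLpRestrictCLM_coeFn ℂ (Ioi (0:ℝ))
    ((gaussianSchwartz ℝ (π * c)).toLp 2 (volume : Measure ℝ)) (p := 2)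
  have h2 : (((gaussianSchwartz ℝ (π * c)).toLp 2 (volume : Measure ℝ) : Lp ℂ 2 (volume : Measure ℝ))
      : ℝ → ℂ) =ᵐ[volume.restrict (Ioi (0:ℝ))]
      fun t : ℝ ↦ ((Real.exp (-(π * c) * t ^ 2) : ℝ) : ℂ) := by
    have h := (gaussianSchwartz ℝ (π * c)).coeFn_toLp 2 (volume : Measure ℝ)
    rw [coe_gaussianSchwartz_real (mul_pos Real.pi_pos hc)] at h
    exact ae_restrict_of_ae h
  exact (h1.trans h2).trans (MemLp.coeFn_toLp _).symm

/-- **`𝓜γ_c` on the critical line**: the Mellin–Plancherel transform of (the `L²(0,∞)` class of)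
`γ_c = e^{−πct²}` is `ξ ↦ c^{−s/2}Γℝ(s)/2`, `s = ½ + 2πiξ`, almost everywhere. [cite: Burnol2004b, §1 p. 4 (arXiv:math/0203120v7, TeX l.348–363)] -/
theorem mellinL2_gauss {c : ℝ} (hc : 0 < c) :
    (MellinL2.mellinL2 (LpToLpRestrictCLM ℝ ℂ ℂ (volume : Measure ℝ) 2 (Ioi (0:ℝ))
        ((gaussianSchwartz ℝ (π * c)).toLp 2)) : ℝ → ℂ) =ᵐ[volume]
      fun ξ : ℝ ↦ (c : ℂ) ^ (-((1 / 2 + 2 * π * ξ * I) / 2)) * (Gammaℝ (1 / 2 + 2 * π * ξ * I) / 2) := by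
  rw [restrict_toLp_gaussianSchwartz hc]
  refine (MellinL2.mellinL2_toLp_ae_eq_mellin (memLp_gaussFun_restrict hc)
    (mellinConvergent_gaussFun hc (by norm_num))).trans (Eventually.of_forall fun ξ ↦ ?_)
  have hre : 0 < (1 / 2 + 2 * π * ξ * I : ℂ).re := by simp
  exact mellin_gaussFun hc hre

/-- **`𝓕γ_c = c^{−1/2}γ_{1/c}`** for the Gaussian Schwartz functions on `ℝ` (`c > 0`).
[cite: Grafakos2014, Example 2.2.9, PDF p. 125] -/
theorem fourier_gaussianSchwartz {c : ℝ} (hc : 0 < c) :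
    𝓕 (gaussianSchwartz ℝ (π * c)) = ((c : ℂ) ^ (-(1 / 2 : ℂ))) • gaussianSchwartz ℝ (π * c⁻¹) := by
  ext x
  rw [SchwartzMap.fourier_coe, smul_apply, coe_gaussianSchwartz_real (mul_pos Real.pi_pos hc),
    gaussianSchwartz_real_apply (mul_pos Real.pi_pos (inv_pos.2 hc))]
  have hb : 0 < ((c : ℂ)).re := by simpa using hc
  have hfun : (fun x : ℝ ↦ ((Real.exp (-(π * c) * x ^ 2) : ℝ) : ℂ)) =
      fun x : ℝ ↦ Complex.exp (-π * (c : ℂ) * (x : ℂ) ^ 2) := by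
    funext y
    push_cast
    ring_nf
  rw [hfun, fourier_gaussian_pi hb]
  simp only [smul_eq_mul]
  push_cast
  rw [one_div, ← cpow_neg]
  ring_nf

/-- **`𝓕[γ_c] = c^{−1/2}[γ_{1/c}]`** in `L²(ℝ)` (`c > 0`). [cite: Grafakos2014, Example 2.2.9 and Thm. 2.2.14, PDF pp. 125–128] -/
theorem fourier_toLp_gaussianSchwartz {c : ℝ} (hc : 0 < c) :
    (𝓕 ((gaussianSchwartz ℝ (π * c)).toLp 2 : Lp ℂ 2 (volume : Measure ℝ)) : Lp ℂ 2 (volume : Measure ℝ))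
      = ((c : ℂ) ^ (-(1 / 2 : ℂ))) • (gaussianSchwartz ℝ (π * c⁻¹)).toLp 2 := by
  rw [SchwartzMap.toLp_fourier_eq, fourier_gaussianSchwartz hc]
  refine Lp.ext ?_
  have h1 := ((c : ℂ) ^ (-(1 / 2 : ℂ)) • gaussianSchwartz ℝ (π * c⁻¹)).coeFn_toLp 2 (volume : Measure ℝ)
  have h2 := (gaussianSchwartz ℝ (π * c⁻¹)).coeFn_toLp 2 (volume : Measure ℝ)
  have h3 := Lp.coeFn_smul ((c : ℂ) ^ (-(1 / 2 : ℂ)))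
    ((gaussianSchwartz ℝ (π * c⁻¹)).toLp 2 (volume : Measure ℝ))
  filter_upwards [h1, h2, h3] with x hx1 hx2 hx3
  rw [hx1, hx3, Pi.smul_apply, hx2]
  rfl

/-! ## Part B. The symbol `m(ξ) = Γℝ(½ + 2πiξ)/Γℝ(½ − 2πiξ)` -/

/-- `Γℝ(s̄) = conj Γℝ(s)` (private copy of `Literature.NumberTheory.LFunctions.Gammaℝ_conj` of
`RiemannSiegelPhase.lean`, not imported here to keep this `Analysis` file below `NumberTheory`). [folklore] -/
private theorem Gammaℝ_conj (s : ℂ) : Gammaℝ (conj s) = conj (Gammaℝ s) := by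
  have harg : ((π : ℂ)).arg ≠ Real.pi := by
    rw [Complex.arg_ofReal_of_nonneg Real.pi_pos.le]; exact Real.pi_pos.ne
  rw [Gammaℝ_def, Gammaℝ_def, map_mul, ← Complex.Gamma_conj, map_div₀, Complex.conj_ofNat]
  congr 1
  have : -conj s / 2 = conj (-s / 2) := by
    rw [map_div₀, map_neg, Complex.conj_ofNat]
  rw [this, Complex.cpow_conj _ _ harg, Complex.conj_ofReal]

/-- On the critical line, `1 − s = s̄`: `½ − 2πiξ = conj(½ + 2πiξ)`. [folklore] -/
private theorem one_sub_line (ξ : ℝ) : (1 - (1 / 2 + 2 * π * ξ * I) : ℂ) = 1 / 2 - 2 * π * ξ * I := by ring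

/-- On the critical line, `½ − 2πiξ = conj(½ + 2πiξ)`. [folklore] -/
private theorem conj_line (ξ : ℝ) : conj (1 / 2 + 2 * π * ξ * I : ℂ) = 1 / 2 - 2 * π * ξ * I := by
  apply Complex.ext <;> simp

/-- `Γℝ(½ − 2πiξ) = conj Γℝ(½ + 2πiξ)`. [cite: Burnol2004b, §1 p. 4 (arXiv:math/0203120v7, TeX l.348–363)] -/
theorem Gammaℝ_line_neg (ξ : ℝ) :
    Gammaℝ (1 / 2 - 2 * π * ξ * I) = conj (Gammaℝ (1 / 2 + 2 * π * ξ * I)) := by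
  rw [← conj_line, Gammaℝ_conj]

/-- `Γℝ` does not vanish on the critical line. [cite: Burnol2004b, §1 p. 4 (arXiv:math/0203120v7, TeX l.348–363)] -/
theorem Gammaℝ_line_ne_zero (ξ : ℝ) : Gammaℝ (1 / 2 + 2 * π * ξ * I) ≠ 0 :=
  Gammaℝ_ne_zero_of_re_pos (by simp)

/-- `Γℝ(½ − 2πiξ) ≠ 0`. [cite: Burnol2004b, §1 p. 4 (arXiv:math/0203120v7, TeX l.348–363)] -/
theorem Gammaℝ_line_neg_ne_zero (ξ : ℝ) : Gammaℝ (1 / 2 - 2 * π * ξ * I) ≠ 0 :=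
  Gammaℝ_ne_zero_of_re_pos (by simp)

/-- The symbol `m(ξ) = Γℝ(½ + 2πiξ)/Γℝ(½ − 2πiξ)` is unimodular. [cite: Burnol2004b, §1 p. 4 (arXiv:math/0203120v7, TeX l.348–363)] -/
theorem norm_symbol (ξ : ℝ) :
    ‖Gammaℝ (1 / 2 + 2 * π * ξ * I) / Gammaℝ (1 / 2 - 2 * π * ξ * I)‖ = 1 := by
  rw [Gammaℝ_line_neg, norm_div, Complex.norm_conj, div_self]
  exact norm_ne_zero_iff.2 (Gammaℝ_line_ne_zero ξ)

/-- `ξ ↦ Γℝ(l(ξ))⁻¹` is continuous for a continuous `l`: `s ↦ Γℝ(s)⁻¹` is entire. [folklore] -/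
private theorem continuous_Gammaℝ_inv_comp {l : ℝ → ℂ} (hl : Continuous l) :
    Continuous fun ξ : ℝ ↦ (Gammaℝ (l ξ))⁻¹ :=
  differentiable_Gammaℝ_inv.continuous.comp hl

/-- `ξ ↦ Γℝ(l(ξ))` is continuous for a continuous `l` avoiding the poles of `Γℝ`. [folklore] -/
private theorem continuous_Gammaℝ_comp {l : ℝ → ℂ} (hl : Continuous l) (h0 : ∀ ξ, Gammaℝ (l ξ) ≠ 0) :
    Continuous fun ξ : ℝ ↦ Gammaℝ (l ξ) := by
  have h : (fun ξ : ℝ ↦ Gammaℝ (l ξ)) = fun ξ ↦ ((Gammaℝ (l ξ))⁻¹)⁻¹ := by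
    funext ξ; rw [inv_inv]
  rw [h]
  exact (continuous_Gammaℝ_inv_comp hl).inv₀ fun ξ ↦ inv_ne_zero (h0 ξ)

/-- The symbol `m` is continuous. [cite: Burnol2004b, §1 p. 4 (arXiv:math/0203120v7, TeX l.348–363)] -/
theorem continuous_symbol :
    Continuous fun ξ : ℝ ↦ Gammaℝ (1 / 2 + 2 * π * ξ * I) / Gammaℝ (1 / 2 - 2 * π * ξ * I) := by
  have hl1 : Continuous fun ξ : ℝ ↦ (1 / 2 + 2 * π * ξ * I : ℂ) := by fun_prop
  have hl2 : Continuous fun ξ : ℝ ↦ (1 / 2 - 2 * π * ξ * I : ℂ) := by fun_prop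
  exact (continuous_Gammaℝ_comp hl1 Gammaℝ_line_ne_zero).div
    (continuous_Gammaℝ_comp hl2 Gammaℝ_line_neg_ne_zero) Gammaℝ_line_neg_ne_zero

/-- The symbol `m` is an `L^∞(ℝ)` function (continuous and unimodular). [cite: Burnol2004b, §1 p. 4 (arXiv:math/0203120v7, TeX l.348–363)] -/
theorem memLp_top_symbol :
    MemLp (fun ξ : ℝ ↦ Gammaℝ (1 / 2 + 2 * π * ξ * I) / Gammaℝ (1 / 2 - 2 * π * ξ * I)) ∞
      (volume : Measure ℝ) :=
  memLp_top_of_bound continuous_symbol.aestronglyMeasurable 1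
    (Eventually.of_forall fun ξ ↦ (norm_symbol ξ).le)


/-! ## Part C. The two sides of the identity; agreement on the Gaussians -/

/-- The a.e. formula of the `L^∞(ℝ)` class of the symbol `m`. [cite: Burnol2004b, §1 p. 4 (arXiv:math/0203120v7, TeX l.348–363)] -/
theorem coeFn_symbol :
    ((memLp_top_symbol.toLp _ : Lp ℂ ∞ (volume : Measure ℝ)) : ℝ → ℂ) =ᵐ[volume]
      fun ξ : ℝ ↦ Gammaℝ (1 / 2 + 2 * π * ξ * I) / Gammaℝ (1 / 2 - 2 * π * ξ * I) :=
  memLp_top_symbol.coeFn_toLp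

/-- The a.e. formula of the right-hand side `v ↦ m · (R v)`: `(m • Rv)(ξ) = m(ξ) v(−ξ)`. [cite: Burnol2004b, §1 p. 4 (arXiv:math/0203120v7, TeX l.348–363)] -/
theorem coeFn_symbol_smul_compNeg (v : Lp ℂ 2 (volume : Measure ℝ)) :
    ((((memLp_top_symbol.toLp _ : Lp ℂ ∞ (volume : Measure ℝ)) •
        (Lp.compMeasurePreserving (fun x : ℝ => -x) (Measure.measurePreserving_neg (volume : Measure ℝ))
          v)) : Lp ℂ 2 (volume : Measure ℝ)) : ℝ → ℂ) =ᵐ[volume]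
      fun ξ : ℝ ↦ Gammaℝ (1 / 2 + 2 * π * ξ * I) / Gammaℝ (1 / 2 - 2 * π * ξ * I) *
        (v : ℝ → ℂ) (-ξ) := by
  filter_upwards [Lp.coeFn_lpSMul (r := 2) (memLp_top_symbol.toLp _ : Lp ℂ ∞ (volume : Measure ℝ))
      (Lp.compMeasurePreserving (fun x : ℝ => -x) (Measure.measurePreserving_neg (volume : Measure ℝ)) v),
    coeFn_symbol, Literature.Analysis.Fourier.coeFn_compNeg v] with ξ h1 h2 h3
  rw [h1, Pi.smul_apply', h2, h3, smul_eq_mul]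

/-- `𝓜γ_c` read at `−ξ`: `𝓜(res γ_c)(−ξ) = c^{−s'/2}Γℝ(s')/2` with `s' = ½ − 2πiξ`, a.e. [cite: Burnol2004b, §1 p. 4 (arXiv:math/0203120v7, TeX l.348–363)] -/
theorem mellinL2_gauss_neg {c : ℝ} (hc : 0 < c) :
    (fun ξ : ℝ ↦ (MellinL2.mellinL2 (LpToLpRestrictCLM ℝ ℂ ℂ (volume : Measure ℝ) 2 (Ioi (0:ℝ))
        ((gaussianSchwartz ℝ (π * c)).toLp 2)) : ℝ → ℂ) (-ξ)) =ᵐ[volume]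
      fun ξ : ℝ ↦ (c : ℂ) ^ (-((1 / 2 - 2 * π * ξ * I) / 2)) * (Gammaℝ (1 / 2 - 2 * π * ξ * I) / 2) := by
  have hq : Measure.QuasiMeasurePreserving (fun x : ℝ => -x) volume volume :=
    (Measure.measurePreserving_neg (volume : Measure ℝ)).quasiMeasurePreserving
  filter_upwards [hq.ae_eq (mellinL2_gauss hc)] with ξ h
  simp only [Function.comp_apply] at h
  rw [h]
  push_cast
  ring_nf

/-- **The identity on the Gaussians** (`c > 0`): `𝓜(res(𝓕γ_c)) = m · R(𝓜(res γ_c))` in `L²(ℝ, dξ)` —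
both sides are `ξ ↦ c^{(s−1)/2}Γℝ(s)/2`, `s = ½ + 2πiξ`. [cite: Burnol2004b, §1 p. 4 (arXiv:math/0203120v7, TeX l.348–363)] -/
theorem gauss_identity {c : ℝ} (hc : 0 < c) :
    MellinL2.mellinL2 (LpToLpRestrictCLM ℝ ℂ ℂ (volume : Measure ℝ) 2 (Ioi (0:ℝ))
        (𝓕 ((gaussianSchwartz ℝ (π * c)).toLp 2 : Lp ℂ 2 (volume : Measure ℝ)) :
          Lp ℂ 2 (volume : Measure ℝ)))
      = (memLp_top_symbol.toLp _ : Lp ℂ ∞ (volume : Measure ℝ)) •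
        Lp.compMeasurePreserving (fun x : ℝ => -x) (Measure.measurePreserving_neg (volume : Measure ℝ))
          (MellinL2.mellinL2 (LpToLpRestrictCLM ℝ ℂ ℂ (volume : Measure ℝ) 2 (Ioi (0:ℝ))
            ((gaussianSchwartz ℝ (π * c)).toLp 2))) := by
  apply Lp.ext
  rw [fourier_toLp_gaussianSchwartz hc, map_smul, map_smul]
  have hL := Lp.coeFn_smul ((c : ℂ) ^ (-(1 / 2 : ℂ)))
    (MellinL2.mellinL2 (LpToLpRestrictCLM ℝ ℂ ℂ (volume : Measure ℝ) 2 (Ioi (0:ℝ))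
      ((gaussianSchwartz ℝ (π * c⁻¹)).toLp 2)))
  have hc' : (c : ℂ) ≠ 0 := ofReal_ne_zero.2 hc.ne'
  filter_upwards [hL, mellinL2_gauss (inv_pos.2 hc), coeFn_symbol_smul_compNeg
      (MellinL2.mellinL2 (LpToLpRestrictCLM ℝ ℂ ℂ (volume : Measure ℝ) 2 (Ioi (0:ℝ))
        ((gaussianSchwartz ℝ (π * c)).toLp 2))), mellinL2_gauss_neg hc] with ξ h1 h2 h3 h4
  rw [h1, Pi.smul_apply, h2, h3, h4, smul_eq_mul, inv_cpow_ofReal hc, neg_neg, ← mul_assoc,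
    ← cpow_add _ _ hc']
  have he : (-(1 / 2 : ℂ) + (1 / 2 + 2 * π * ξ * I) / 2) = -((1 / 2 - 2 * π * ξ * I) / 2) := by ring
  rw [he]
  have key : ∀ (x G G' : ℂ), G' ≠ 0 → x * (G / 2) = G / G' * (x * (G' / 2)) := by
    intro x G G' hG'
    field_simp
  exact key _ _ _ (Gammaℝ_line_neg_ne_zero ξ)

/-! ## Part D. Density of the Gaussians in the even part of `L²(ℝ)` -/

/-- `∫_ℝ h = 2∫₀^∞ h` for an integrable, almost-everywhere even `h`. [folklore] -/
private theorem integral_eq_two_mul_setIntegral_Ioi {h : ℝ → ℂ} (hi : Integrable h)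
    (he : ∀ᵐ x : ℝ, h (-x) = h x) :
    ∫ x, h x = 2 * ∫ x in Ioi (0 : ℝ), h x := by
  rw [← intervalIntegral.integral_Iic_add_Ioi (b := 0) hi.integrableOn hi.integrableOn]
  have : ∫ v in Iic (0 : ℝ), h v = ∫ v in Ioi (0 : ℝ), h v := by
    calc ∫ v in Iic (0 : ℝ), h v = ∫ v in Iic (0 : ℝ), h (-v) :=
          integral_congr_ae (ae_restrict_of_ae (by filter_upwards [he] with v hv; exact hv.symm))
      _ = ∫ v in Ioi (-0 : ℝ), h v := integral_comp_neg_Iic 0 h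
      _ = ∫ v in Ioi (0 : ℝ), h v := by rw [neg_zero]
  rw [this, two_mul]

/-- The inner product of two restrictions to `(0,∞)` is `∫₀^∞ conj(u)·v`. [folklore] -/
private theorem inner_restrict_eq_setIntegral (u v : Lp ℂ 2 (volume : Measure ℝ)) :
    ⟪LpToLpRestrictCLM ℝ ℂ ℂ (volume : Measure ℝ) 2 (Ioi (0:ℝ)) u,
      LpToLpRestrictCLM ℝ ℂ ℂ (volume : Measure ℝ) 2 (Ioi (0:ℝ)) v⟫_ℂ =
      ∫ x in Ioi (0:ℝ), conj ((u : ℝ → ℂ) x) * (v : ℝ → ℂ) x := by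
  rw [L2.inner_def]
  refine integral_congr_ae ?_
  filter_upwards [LpToLpRestrictCLM_coeFn ℂ (Ioi (0:ℝ)) u (p := 2),
    LpToLpRestrictCLM_coeFn ℂ (Ioi (0:ℝ)) v (p := 2)] with x hu hv
  rw [hu, hv, RCLike.inner_apply']

/-- For EVEN `w` and the (even) Gaussian: `⟪γ_c, w⟫_{L²(ℝ)} = 2⟪res γ_c, res w⟫_{L²(0,∞)}`. [folklore] -/
private theorem inner_gauss_eq_two_mul_inner_restrict {c : ℝ} (hc : 0 < c) {w : Lp ℂ 2 (volume : Measure ℝ)}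
    (hw : ∀ᵐ x : ℝ, (w : ℝ → ℂ) (-x) = (w : ℝ → ℂ) x) :
    ⟪((gaussianSchwartz ℝ (π * c)).toLp 2 : Lp ℂ 2 (volume : Measure ℝ)), w⟫_ℂ =
      2 * ⟪LpToLpRestrictCLM ℝ ℂ ℂ (volume : Measure ℝ) 2 (Ioi (0:ℝ))
            ((gaussianSchwartz ℝ (π * c)).toLp 2),
          LpToLpRestrictCLM ℝ ℂ ℂ (volume : Measure ℝ) 2 (Ioi (0:ℝ)) w⟫_ℂ := by
  rw [inner_restrict_eq_setIntegral, L2.inner_def]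
  have hq : Measure.QuasiMeasurePreserving (fun x : ℝ => -x) volume volume :=
    (Measure.measurePreserving_neg (volume : Measure ℝ)).quasiMeasurePreserving
  have hγ := ((gaussianSchwartz ℝ (π * c)).coeFn_toLp 2 (volume : Measure ℝ))
  set γ : Lp ℂ 2 (volume : Measure ℝ) := (gaussianSchwartz ℝ (π * c)).toLp 2 with hγdef
  have hint : Integrable (fun x : ℝ ↦ ⟪(γ : ℝ → ℂ) x, (w : ℝ → ℂ) x⟫_ℂ) := L2.integrable_inner γ w
  have hform : (fun x : ℝ ↦ ⟪(γ : ℝ → ℂ) x, (w : ℝ → ℂ) x⟫_ℂ) =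
      fun x : ℝ ↦ conj ((γ : ℝ → ℂ) x) * (w : ℝ → ℂ) x := by
    funext x; exact RCLike.inner_apply' _ _
  rw [hform] at hint ⊢
  refine integral_eq_two_mul_setIntegral_Ioi hint ?_
  filter_upwards [hw, hγ, hq.ae_eq hγ] with x h1 h2 h3
  simp only [Function.comp_apply] at h3
  rw [h1, h2, h3, gaussianSchwartz_real_apply (mul_pos Real.pi_pos hc),
    gaussianSchwartz_real_apply (mul_pos Real.pi_pos hc), neg_sq]

/-- `((e^{r})^z = e^{rz}` for real `r` (principal power of a positive real). [folklore] -/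
private theorem exp_ofReal_cpow (r : ℝ) (z : ℂ) : ((Real.exp r : ℝ) : ℂ) ^ z = Complex.exp (r * z) := by
  rw [cpow_def_of_ne_zero (ofReal_ne_zero.2 (Real.exp_pos r).ne'), ← ofReal_log (Real.exp_pos r).le,
    Real.log_exp]

/-- `conj(c^z) = c^{conj z}` for a positive real `c`. [folklore] -/
private theorem conj_ofReal_cpow {c : ℝ} (hc : 0 < c) (z : ℂ) : conj ((c : ℂ) ^ z) = (c : ℂ) ^ (conj z) := by
  have harg : ((c : ℂ)).arg ≠ Real.pi := by
    rw [Complex.arg_ofReal_of_nonneg hc.le]; exact Real.pi_pos.ne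
  rw [Complex.cpow_conj _ _ harg, Complex.conj_ofReal]

/-- **Density core.** An EVEN `w ∈ L²(ℝ)` orthogonal to every Gaussian `γ_c = e^{−πcx²}` (`c > 0`)
vanishes: its restriction `v = res w` satisfies `𝓜v ⊥ 𝓜(res γ_c) = c^{−1/4}c^{−πiξ}Γℝ(½+2πiξ)/2`
for all `c = e^{−2b}`, i.e. the Fourier transform of the integrable function
`conj(Γℝ(½+2πi·)/2)·𝓜v` vanishes identically, so `𝓜v = 0`. [cite: Burnol2004b, §1 p. 4 (arXiv:math/0203120v7, TeX l.348–363)] -/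
theorem eq_zero_of_even_of_orthogonal_gauss {w : Lp ℂ 2 (volume : Measure ℝ)}
    (hw : ∀ᵐ x : ℝ, (w : ℝ → ℂ) (-x) = (w : ℝ → ℂ) x)
    (horth : ∀ c : ℝ, 0 < c →
      ⟪((gaussianSchwartz ℝ (π * c)).toLp 2 : Lp ℂ 2 (volume : Measure ℝ)), w⟫_ℂ = 0) :
    w = 0 := by
  set v : Lp ℂ 2 (volume.restrict (Ioi (0:ℝ))) :=
    LpToLpRestrictCLM ℝ ℂ ℂ (volume : Measure ℝ) 2 (Ioi (0:ℝ)) w with hv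
  -- Step 1: `res γ_c ⊥ v` in `L²(0,∞)`, hence `𝓜(res γ_c) ⊥ 𝓜v`
  have h1 : ∀ c : ℝ, 0 < c →
      ⟪MellinL2.mellinL2 (LpToLpRestrictCLM ℝ ℂ ℂ (volume : Measure ℝ) 2 (Ioi (0:ℝ))
          ((gaussianSchwartz ℝ (π * c)).toLp 2)), MellinL2.mellinL2 v⟫_ℂ = 0 := by
    intro c hc
    rw [LinearIsometryEquiv.inner_map_map]
    have h := inner_gauss_eq_two_mul_inner_restrict hc hw
    rw [horth c hc] at h
    exact (mul_eq_zero.1 h.symm).resolve_left two_ne_zero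
  -- the integrable function `k = conj(𝓜(res γ_1)) · 𝓜v`, i.e. `conj(Γℝ(s)/2)·𝓜v(ξ)`
  set F₁ : Lp ℂ 2 (volume : Measure ℝ) := MellinL2.mellinL2
    (LpToLpRestrictCLM ℝ ℂ ℂ (volume : Measure ℝ) 2 (Ioi (0:ℝ)) ((gaussianSchwartz ℝ (π * 1)).toLp 2))
    with hF₁
  set k : ℝ → ℂ := fun ξ ↦ conj (Gammaℝ (1 / 2 + 2 * π * ξ * I) / 2) *
    (MellinL2.mellinL2 v : ℝ → ℂ) ξ with hk
  have hF₁ae : (F₁ : ℝ → ℂ) =ᵐ[volume] fun ξ ↦ Gammaℝ (1 / 2 + 2 * π * ξ * I) / 2 := by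
    filter_upwards [mellinL2_gauss one_pos] with ξ h
    rw [h, ofReal_one, one_cpow, one_mul]
  have hk_int : Integrable k := by
    refine (L2.integrable_inner F₁ (MellinL2.mellinL2 v)).congr ?_
    filter_upwards [hF₁ae] with ξ h
    rw [hk, RCLike.inner_apply', h]
  -- Step 2: `𝓕k(b) = 0` for every `b`
  have h2 : ∀ b : ℝ, 𝓕 k b = 0 := by
    intro b
    set c : ℝ := Real.exp (-(2 * b)) with hcdef
    have hc : 0 < c := Real.exp_pos _
    have h := h1 c hc
    rw [L2.inner_def] at h
    have hrepr : ∫ ξ : ℝ, ⟪(MellinL2.mellinL2 (LpToLpRestrictCLM ℝ ℂ ℂ (volume : Measure ℝ) 2 (Ioi (0:ℝ))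
        ((gaussianSchwartz ℝ (π * c)).toLp 2)) : ℝ → ℂ) ξ, (MellinL2.mellinL2 v : ℝ → ℂ) ξ⟫_ℂ =
        ∫ ξ : ℝ, Complex.exp ((b / 2 : ℝ) : ℂ) * (Complex.exp (↑(-2 * π * ξ * b) * I) • k ξ) := by
      refine integral_congr_ae ?_
      filter_upwards [mellinL2_gauss hc] with ξ hξ
      rw [RCLike.inner_apply', hξ, map_mul, conj_ofReal_cpow hc, hcdef, exp_ofReal_cpow, hk,
        smul_eq_mul]
      have : conj (-((1 / 2 + 2 * π * ξ * I) / 2) : ℂ) = -((1 / 2 - 2 * π * ξ * I) / 2) := by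
        rw [map_neg, map_div₀, conj_line, Complex.conj_ofNat]
      rw [this, ← mul_assoc, ← mul_assoc, ← Complex.exp_add]
      congr 2
      push_cast
      ring
    rw [hrepr, integral_const_mul, mul_eq_zero] at h
    rcases h with h | h
    · exact absurd h (Complex.exp_ne_zero _)
    · rw [Real.fourier_real_eq_integral_exp_smul]
      exact h
  -- Step 3: `k = 0` a.e., hence `𝓜v = 0` a.e., hence `v = 0`
  have h3 : k =ᵐ[volume] 0 := Literature.Analysis.Fourier.ae_eq_zero_of_forall_fourier_eq_zero hk_int h2
  have h4 : MellinL2.mellinL2 v = 0 := by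
    apply Lp.ext
    filter_upwards [h3, Lp.coeFn_zero ℂ 2 (volume : Measure ℝ)] with ξ hξ h0
    rw [h0]
    have hne : conj (Gammaℝ (1 / 2 + 2 * π * ξ * I) / 2) ≠ 0 := by
      rw [map_ne_zero]
      exact div_ne_zero (Gammaℝ_line_ne_zero ξ) two_ne_zero
    have hξ' : conj (Gammaℝ (1 / 2 + 2 * π * ξ * I) / 2) * (MellinL2.mellinL2 v : ℝ → ℂ) ξ = 0 := by
      simpa only [hk, Pi.zero_apply] using hξ
    exact (mul_eq_zero.1 hξ').resolve_left hne
  have h5 : v = 0 := by simpa using h4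
  -- Step 4: `w = 0` a.e. on `(0,∞)`, hence (even) everywhere
  have h6 : ∀ᵐ x : ℝ, x ∈ Ioi (0:ℝ) → (w : ℝ → ℂ) x = 0 := by
    rw [← ae_restrict_iff' measurableSet_Ioi]
    have h := LpToLpRestrictCLM_coeFn ℂ (Ioi (0:ℝ)) w (p := 2)
    rw [← hv, h5] at h
    filter_upwards [h, Lp.coeFn_zero ℂ 2 (volume.restrict (Ioi (0:ℝ)))] with x hx h0
    rw [← hx, h0, Pi.zero_apply]
  have hq : Measure.QuasiMeasurePreserving (fun x : ℝ => -x) volume volume :=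
    (Measure.measurePreserving_neg (volume : Measure ℝ)).quasiMeasurePreserving
  have h7 : ∀ᵐ x : ℝ, x ≠ 0 := by
    have : (volume : Measure ℝ) {x | ¬ x ≠ 0} = 0 := by simp
    exact ae_iff.2 this
  apply Lp.ext
  filter_upwards [h6, hq.ae h6, hw, h7, Lp.coeFn_zero ℂ 2 (volume : Measure ℝ)] with x hpos hneg hev hx0 h0
  rw [h0, Pi.zero_apply]
  rcases lt_or_gt_of_ne hx0 with hx | hx
  · rw [← hev]
    exact hneg (by simpa using hx)
  · exact hpos hx

/-- The reflection fixes the Gaussians: `Rγ_c = γ_c`. [folklore] -/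
private theorem compNeg_gauss {c : ℝ} (hc : 0 < c) :
    Lp.compMeasurePreserving (fun x : ℝ => -x) (Measure.measurePreserving_neg (volume : Measure ℝ))
      ((gaussianSchwartz ℝ (π * c)).toLp 2 : Lp ℂ 2 (volume : Measure ℝ)) =
      (gaussianSchwartz ℝ (π * c)).toLp 2 := by
  have hq : Measure.QuasiMeasurePreserving (fun x : ℝ => -x) volume volume :=
    (Measure.measurePreserving_neg (volume : Measure ℝ)).quasiMeasurePreserving
  have hγ := ((gaussianSchwartz ℝ (π * c)).coeFn_toLp 2 (volume : Measure ℝ))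
  apply Lp.ext
  filter_upwards [Literature.Analysis.Fourier.coeFn_compNeg
    ((gaussianSchwartz ℝ (π * c)).toLp 2 (volume : Measure ℝ)), hγ, hq.ae_eq hγ] with x h1 h2 h3
  simp only [Function.comp_apply] at h3
  rw [h1, h3, h2, gaussianSchwartz_real_apply (mul_pos Real.pi_pos hc),
    gaussianSchwartz_real_apply (mul_pos Real.pi_pos hc), neg_sq]

/-- The reflection fixes an even class: `Ru = u`. [folklore] -/
private theorem compNeg_eq_self_of_even {u : Lp ℂ 2 (volume : Measure ℝ)}
    (hu : ∀ᵐ x : ℝ, (u : ℝ → ℂ) (-x) = (u : ℝ → ℂ) x) :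
    Lp.compMeasurePreserving (fun x : ℝ => -x) (Measure.measurePreserving_neg (volume : Measure ℝ)) u
      = u :=
  Lp.ext ((Literature.Analysis.Fourier.coeFn_compNeg u).trans hu)

/-- **Density**: every EVEN `u ∈ L²(ℝ)` lies in the closed span of the Gaussians `γ_c`, `c > 0`
(`= (span)ᗮᗮ`: a vector `w ⊥ span{γ_c}` has `w + Rw` even and `⊥ span{γ_c}`, hence `Rw = −w`
by the density core, hence `⟪w, u⟫ = ⟪Rw, Ru⟫ = −⟪w, u⟫`). [cite: Burnol2004b, §1 p. 4 (arXiv:math/0203120v7, TeX l.348–363)] -/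
theorem mem_closure_span_gauss_of_even {u : Lp ℂ 2 (volume : Measure ℝ)}
    (hu : ∀ᵐ x : ℝ, (u : ℝ → ℂ) (-x) = (u : ℝ → ℂ) x) :
    u ∈ (Submodule.span ℂ ((fun c : ℝ ↦ ((gaussianSchwartz ℝ (π * c)).toLp 2 :
        Lp ℂ 2 (volume : Measure ℝ))) '' Ioi (0:ℝ))).topologicalClosure := by
  rw [← Submodule.orthogonal_orthogonal_eq_closure, Submodule.mem_orthogonal]
  intro w hw
  rw [Submodule.mem_orthogonal] at hw
  set R := Lp.compMeasurePreservingₗᵢ ℂ (fun x : ℝ => -x)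
    (Measure.measurePreserving_neg (volume : Measure ℝ)) (E := ℂ) (p := 2) with hRdef
  have hR : ∀ z : Lp ℂ 2 (volume : Measure ℝ), R z =
      Lp.compMeasurePreserving (fun x : ℝ => -x) (Measure.measurePreserving_neg (volume : Measure ℝ)) z :=
    fun z ↦ rfl
  have hq : Measure.QuasiMeasurePreserving (fun x : ℝ => -x) volume volume :=
    (Measure.measurePreserving_neg (volume : Measure ℝ)).quasiMeasurePreserving
  -- `w' = w + Rw` is even and orthogonal to every Gaussian
  have hw'even : ∀ᵐ x : ℝ, ((w + R w : Lp ℂ 2 (volume : Measure ℝ)) : ℝ → ℂ) (-x) =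
      ((w + R w : Lp ℂ 2 (volume : Measure ℝ)) : ℝ → ℂ) x := by
    have ha := Lp.coeFn_add w (R w)
    have hRw : (R w : ℝ → ℂ) =ᵐ[volume] fun x ↦ (w : ℝ → ℂ) (-x) := by
      rw [hR]; exact Literature.Analysis.Fourier.coeFn_compNeg w
    filter_upwards [ha, hq.ae_eq ha, hRw, hq.ae_eq hRw] with x h1 h2 h3 h4
    simp only [Function.comp_apply] at h2 h4
    rw [h1, h2, Pi.add_apply, Pi.add_apply, h3, h4, neg_neg, add_comm]
  have hw'orth : ∀ c : ℝ, 0 < c →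
      ⟪((gaussianSchwartz ℝ (π * c)).toLp 2 : Lp ℂ 2 (volume : Measure ℝ)), w + R w⟫_ℂ = 0 := by
    intro c hc
    have hγ : ((gaussianSchwartz ℝ (π * c)).toLp 2 : Lp ℂ 2 (volume : Measure ℝ)) ∈
        Submodule.span ℂ ((fun c : ℝ ↦ ((gaussianSchwartz ℝ (π * c)).toLp 2 :
          Lp ℂ 2 (volume : Measure ℝ))) '' Ioi (0:ℝ)) :=
      Submodule.subset_span ⟨c, hc, rfl⟩
    have h0 := hw _ hγ
    have hRγ : R ((gaussianSchwartz ℝ (π * c)).toLp 2) = (gaussianSchwartz ℝ (π * c)).toLp 2 := by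
      rw [hR]; exact compNeg_gauss hc
    have hRR : R (R w) = w := by
      rw [hR, hR]; exact Literature.Analysis.Fourier.compNeg_compNeg w
    have h1 : ⟪((gaussianSchwartz ℝ (π * c)).toLp 2 : Lp ℂ 2 (volume : Measure ℝ)), R w⟫_ℂ = 0 := by
      rw [← R.inner_map_map, hRγ, hRR, h0]
    rw [inner_add_right, h0, h1, add_zero]
  have hw' : w + R w = 0 := eq_zero_of_even_of_orthogonal_gauss hw'even hw'orth
  have hRw : R w = -w := eq_neg_of_add_eq_zero_right hw'
  have hRu : R u = u := by rw [hR]; exact compNeg_eq_self_of_even hu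
  have h := R.inner_map_map w u
  rw [hRw, hRu, inner_neg_left] at h
  -- `-⟪w,u⟫ = ⟪w,u⟫`
  have : (2 : ℂ) * ⟪w, u⟫_ℂ = 0 := by rw [two_mul]; nth_rw 1 [← h]; ring
  exact (mul_eq_zero.1 this).resolve_left two_ne_zero

/-! ## Part E. The multiplier identity for every even `u ∈ L²(ℝ)` -/

/-- **The Mellin–Plancherel transform diagonalises the cosine transform** (operator form): for an
almost-everywhere EVEN `u ∈ L²(ℝ)`, `𝓜(res(𝓕u)) = m • R(𝓜(res u))` in `L²(ℝ, dξ)`, where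
`res = LpToLpRestrictCLM ℝ ℂ ℂ volume 2 (Ioi 0)`, `𝓜 = MellinL2.mellinL2` (line `s = ½ + 2πiξ`),
`R` is the reflection `ξ ↦ −ξ` and `m = Γℝ(½+2πiξ)/Γℝ(½−2πiξ)` acts as an `L^∞` class.
[cite: Burnol2004b, §1 p. 4 (arXiv:math/0203120v7, TeX l.348–363)] -/
theorem mellinL2_restrict_fourier_eq_of_even {u : Lp ℂ 2 (volume : Measure ℝ)}
    (hu : ∀ᵐ x : ℝ, (u : ℝ → ℂ) (-x) = (u : ℝ → ℂ) x) :
    MellinL2.mellinL2 (LpToLpRestrictCLM ℝ ℂ ℂ (volume : Measure ℝ) 2 (Ioi (0:ℝ))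
        (𝓕 u : Lp ℂ 2 (volume : Measure ℝ)))
      = (memLp_top_symbol.toLp _ : Lp ℂ ∞ (volume : Measure ℝ)) •
        Lp.compMeasurePreserving (fun x : ℝ => -x) (Measure.measurePreserving_neg (volume : Measure ℝ))
          (MellinL2.mellinL2 (LpToLpRestrictCLM ℝ ℂ ℂ (volume : Measure ℝ) 2 (Ioi (0:ℝ)) u)) := by
  -- the two sides as continuous linear maps `L²(ℝ) → L²(ℝ, dξ)`
  set Mφ : Lp ℂ 2 (volume : Measure ℝ) →L[ℂ] Lp ℂ 2 (volume : Measure ℝ) :=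
    LinearMap.mkContinuous
      { toFun := fun g ↦ ((memLp_top_symbol.toLp _ : Lp ℂ ∞ (volume : Measure ℝ)) • g :
            Lp ℂ 2 (volume : Measure ℝ))
        map_add' := fun g₁ g₂ ↦ Lp.add_smul _ g₁ g₂
        map_smul' := fun a g ↦ (Lp.smul_comm a _ g).symm }
      ‖(memLp_top_symbol.toLp _ : Lp ℂ ∞ (volume : Measure ℝ))‖ (fun g ↦ Lp.norm_smul_le _ g)
    with hMφ_def
  have hMφ : ∀ g : Lp ℂ 2 (volume : Measure ℝ),
      Mφ g = (memLp_top_symbol.toLp _ : Lp ℂ ∞ (volume : Measure ℝ)) • g := fun g ↦ rfl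
  set Rc : Lp ℂ 2 (volume : Measure ℝ) →L[ℂ] Lp ℂ 2 (volume : Measure ℝ) :=
    (Lp.compMeasurePreservingₗᵢ ℂ (fun x : ℝ => -x)
      (Measure.measurePreserving_neg (volume : Measure ℝ)) (E := ℂ) (p := 2)).toContinuousLinearMap
    with hRc_def
  have hRc : ∀ g : Lp ℂ 2 (volume : Measure ℝ), Rc g =
      Lp.compMeasurePreserving (fun x : ℝ => -x) (Measure.measurePreserving_neg (volume : Measure ℝ)) g :=
    fun g ↦ rfl
  set Mc : Lp ℂ 2 (volume.restrict (Ioi (0:ℝ))) →L[ℂ] Lp ℂ 2 (volume : Measure ℝ) :=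
    (MellinL2.mellinL2.toContinuousLinearEquiv :
      Lp ℂ 2 (volume.restrict (Ioi (0:ℝ))) →L[ℂ] Lp ℂ 2 (volume : Measure ℝ)) with hMc_def
  have hMc : ∀ g, Mc g = MellinL2.mellinL2 g := fun g ↦ rfl
  set Fc : Lp ℂ 2 (volume : Measure ℝ) →L[ℂ] Lp ℂ 2 (volume : Measure ℝ) :=
    ((Lp.fourierTransformₗᵢ ℝ ℂ).toContinuousLinearEquiv :
      Lp ℂ 2 (volume : Measure ℝ) →L[ℂ] Lp ℂ 2 (volume : Measure ℝ)) with hFc_def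
  have hFc : ∀ g : Lp ℂ 2 (volume : Measure ℝ), Fc g = (𝓕 g : Lp ℂ 2 (volume : Measure ℝ)) :=
    fun g ↦ rfl
  set res := LpToLpRestrictCLM ℝ ℂ ℂ (volume : Measure ℝ) 2 (Ioi (0:ℝ)) with hres
  set A : Lp ℂ 2 (volume : Measure ℝ) →L[ℂ] Lp ℂ 2 (volume : Measure ℝ) := Mc.comp (res.comp Fc)
    with hA_def
  set B : Lp ℂ 2 (volume : Measure ℝ) →L[ℂ] Lp ℂ 2 (volume : Measure ℝ) :=
    Mφ.comp (Rc.comp (Mc.comp res)) with hB_def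
  have hA : ∀ g, A g = MellinL2.mellinL2 (res (𝓕 g : Lp ℂ 2 (volume : Measure ℝ))) := fun g ↦ rfl
  have hB : ∀ g, B g = (memLp_top_symbol.toLp _ : Lp ℂ ∞ (volume : Measure ℝ)) •
      Lp.compMeasurePreserving (fun x : ℝ => -x) (Measure.measurePreserving_neg (volume : Measure ℝ))
        (MellinL2.mellinL2 (res g)) := fun g ↦ rfl
  -- they agree on the span of the Gaussians, a dense subset of the even classes
  have hker : Submodule.span ℂ ((fun c : ℝ ↦ ((gaussianSchwartz ℝ (π * c)).toLp 2 :
      Lp ℂ 2 (volume : Measure ℝ))) '' Ioi (0:ℝ)) ≤ LinearMap.ker (A - B).toLinearMap := by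
    refine Submodule.span_le.2 ?_
    rintro _ ⟨c, hc, rfl⟩
    simp only [SetLike.mem_coe, LinearMap.mem_ker, ContinuousLinearMap.coe_coe,
      sub_apply, hA, hB, sub_eq_zero]
    exact gauss_identity hc
  have hcl : (Submodule.span ℂ ((fun c : ℝ ↦ ((gaussianSchwartz ℝ (π * c)).toLp 2 :
      Lp ℂ 2 (volume : Measure ℝ))) '' Ioi (0:ℝ))).topologicalClosure ≤
      LinearMap.ker (A - B).toLinearMap :=
    Submodule.topologicalClosure_minimal _ hker (ContinuousLinearMap.isClosed_ker (A - B))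
  have h := hcl (mem_closure_span_gauss_of_even hu)
  rw [LinearMap.mem_ker, ContinuousLinearMap.coe_coe, sub_apply, sub_eq_zero, hA, hB] at h
  exact h

/-- **The Mellin–Plancherel transform diagonalises the cosine transform** (a.e. form): for an
almost-everywhere EVEN `u ∈ L²(ℝ)`,
`𝓜(res(𝓕u))(ξ) = (Γℝ(½ + 2πiξ)/Γℝ(½ − 2πiξ)) · 𝓜(res u)(−ξ)` for a.e. `ξ`
(LEFT Mellin convention of `MellinL2.mellinL2`, line `s = ½ + 2πiξ`; in Burnol's right-Mellin
notation `f̂(s) = 𝓜f(1−s)`: `𝓕₊(f)^(s) = χ(s)f̂(1−s)`, `χ(s) = Γℝ(1−s)/Γℝ(s)`).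
[cite: Burnol2004b, §1 p. 4 (arXiv:math/0203120v7, TeX l.348–363)] -/
theorem mellinL2_restrict_fourier_of_even {u : Lp ℂ 2 (volume : Measure ℝ)}
    (hu : ∀ᵐ x : ℝ, (u : ℝ → ℂ) (-x) = (u : ℝ → ℂ) x) :
    (MellinL2.mellinL2 (LpToLpRestrictCLM ℝ ℂ ℂ (volume : Measure ℝ) 2 (Ioi (0:ℝ))
        (𝓕 u : Lp ℂ 2 (volume : Measure ℝ))) : ℝ → ℂ) =ᵐ[volume]
      fun ξ : ℝ ↦ Gammaℝ (1 / 2 + 2 * π * ξ * I) / Gammaℝ (1 / 2 - 2 * π * ξ * I) *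
        (MellinL2.mellinL2 (LpToLpRestrictCLM ℝ ℂ ℂ (volume : Measure ℝ) 2 (Ioi (0:ℝ)) u) :
          ℝ → ℂ) (-ξ) := by
  rw [mellinL2_restrict_fourier_eq_of_even hu]
  exact coeFn_symbol_smul_compNeg _

end MellinFourierMultiplier

end Literature.Analysis.FunctionSpaces

end
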